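import Mathlib
import HarnessLib
import Summits.Parity.GeneralizedHardyLittlewood.Theses.LeeYangFibres
import Summits.Parity.GeneralizedHardyLittlewood.Theorems.LeeYangFibresAbsoluteUpgradeDipReduction

/-!
# Route `LeeYangFibres` — support item `QuantitativeClipping` (stmt-Parity-18105)

`QuantitativeClipping := CellParityLawSaving → FibreHyperbolicityAlong → DimOne` — the quantitative clipping along
the roughness schedule `u = U(N) = max 4 ⌊√(log log N)/2⌋`: the cell-parity law with a `(log N)^{-δ}` saving and
the Lee–Yang property of every fibre of the joint rough-cell polynomial along the schedule give Hardy–Littlewood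
type absolute asymptotics for every non-degenerate `d = 1` system (`DimOne`).

This is already a theorem of the tree: the reduction theorem
`Summit.Parity.GeneralizedHardyLittlewood.Cruxes.AbsoluteUpgrade.DipMarginRateExchange.dimOne_of_dipInputs`
of line `dip-margin-rate-exchange` (Theorems/LeeYangFibresAbsoluteUpgradeDipReduction: MarginPoly from the
mod-Gamma disc asymptotic and the explicit pencil zero, anatomy along the schedule, QuantClip, CellsToDimOne).
The route's two crux statements `Theses.LeeYangFibres.CellParityLawSaving` / `FibreHyperbolicityAlong` are
definitionally the dip line's `DipMarginRateExchange.CellParityLawSaving` / `FibreHyperbolicityAlong`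
(the latter written through the abbreviating definitions `slowDegree`, `fibre`, `jointCell`, `cell`, which unfold
to the route's verbatim bodies), so the item closes by one application.  The proving module imports the Theses
file, which is why the route carries this implication as a hypothesis of `closes` rather than as an import.
-/

namespace Summit.Parity.GeneralizedHardyLittlewood.Theorems

/-- **Quantitative clipping along the schedule** (route `LeeYangFibres`, support item stmt-Parity-18105):
`CellParityLawSaving → FibreHyperbolicityAlong → DimOne`, by the dip line's reduction theorem
`DipMarginRateExchange.dimOne_of_dipInputs` (the route decls are definitionally the dip line's statements). -/
theorem quantitativeClipping_proof :
    Summit.Parity.GeneralizedHardyLittlewood.Theses.LeeYangFibres.QuantitativeClipping := by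
  unfold Summit.Parity.GeneralizedHardyLittlewood.Theses.LeeYangFibres.QuantitativeClipping
  intro hL hH
  exact Summit.Parity.GeneralizedHardyLittlewood.Cruxes.AbsoluteUpgrade.DipMarginRateExchange.dimOne_of_dipInputs
    hL hH

end Summit.Parity.GeneralizedHardyLittlewood.Theorems
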